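import Summits.CriticalPhenomena.SAWScalingLimit.Theses.SAWExcursionCardy
import Summits.CriticalPhenomena.SAWScalingLimit.Theorems.SAWExcursionCardyCardyFSpec
import Literature.Probability.RandomPlanarGeometry.SAWExcursionAvoidance
import Literature.Probability.LatticeModels.SRWKilledWalkFunctionals

/-!
# Line `birth` — registered skeleton for the crux `ExcursionCardyFormula` (stmt-CriticalPhenomena-4511)

Crux (FIXED; rank 2 of `route-CriticalPhenomena-SAWExcursionCardy`): THE CARDY–FOMIN FORMULA FOR THE SAW —
for every conformal rectangle `R = (Ω; a, c, d, b)` (`pt 0 = a`, `pt 1 = c`, `pt 2 = d`, `pt 3 = b`), every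
endpoint approximation `(a_δ, b_δ)` of `R.chord 0 3 = (Ω; a, b)` and all boundary vertices `c_δ → c`,
`d_δ → d`, the SAW × random-walk-excursion non-intersection probability
`N_δ = ∫ E_δ(γ)/E_δ(∅) dSAW.law(γ)` satisfies `R.HasCrossingLimit N F`, `F(u) = (8/5) u ₂F₁(-1/2, 2; 7/2; u)`:
`N_δ → F(crossRatio x)` for every uniformizing datum `(φ, x)`.

## The cut (the route header's own two-layer plan: "ExcursionCardyFormula ⇐ RWside → SAWside")

The statement mixes two scaling limits of different nature, and the skeleton separates them along the
ONLY lattice-intrinsic conformal modulus available on `ℤ²` without a conformal map, the random-walk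
cross-ratio `√Λ_δ`, `Λ_δ = G(a_δ,d_δ) G(c_δ,b_δ) / (G(a_δ,c_δ) G(d_δ,b_δ))`, `G = SRW.killedGreen (Ω_δ)`
(Green function of simple random walk run along `Ω_δ`-edges and killed at its first non-edge step):

* S1 `stub_rwCrossRatioLimit` — RANDOM-WALK SIDE: `√Λ_δ → crossRatio x` for every uniformizing datum.
  Discrete potential theory only (Kozdron–Lawler 2005, Thm 1.1 / Prop. 3.10: the killed Green function
  factorises near the boundary as local × local × conformal part; in the 4-ratio every marked point occurs
  once upstairs and once downstairs, so the local parts cancel). VERBATIM the route's support item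
  `RWGreenCrossRatioLimit` (stmt-CriticalPhenomena-4515) read through `SRW.killedGreen_def` (`Iff.rfl`,
  certified below), hence already reduced IN THE TREE to the route's rank-7 crux `MartinRatioBoundaryLimit`
  (stmt-CriticalPhenomena-15712) by
  `Theorems.RWGreenCrossRatioLimit_of_martinRatioBoundaryLimit` — size L–XL (unprinted for this
  discretisation: largest mesh component, edge-killed walk), plausibly TRUE unconditionally.
* S2 `stub_avoidanceTracksRWCrossRatio` (HARDEST, the SAW content) — SAW SIDE, LATTICE-INTRINSIC:
  `N_δ − F(min(1, √Λ_δ)) → 0` as `δ → 0⁺`: the non-intersection probability is asymptotically the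
  Cardy–Fomin function of the random-walk modulus of the SAME lattice domain. No conformal map, no
  uniformizing datum: this is the `η = nil` (no prefix, `h_∅ = 1`) content of the route's rank-3 crux
  `SlitExcursionCardy` (stmt-CriticalPhenomena-4512), in `Tendsto` form and in the tree vocabulary
  `SAW.excursionAvoidance` / `sawExcursionF` / `SRW.killedGreen` (all `rfl`-equal to the crux's inline
  `let`s: `SAWExcursionAvoidance.lean`, `SRWKilledWalkFunctionals.lean`). It is where "conformal
  invariance of a SAW functional with no lattice identity behind it" (the crux's why-might-fail) lives;
  its cheapest falsifier is the route's small-box test (tabulate `N_L − F(√Λ_L)` on `L × L` boxes).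

`ExcursionCardyFormula_of` (kernel-checked, no `sorry` of its own): for a uniformizing datum `(φ, x)`,
`η = crossRatio x ∈ (0, 1)` (`crossRatio_mem_Ioo_of_isUniformizing`, proved), so by S1
`min(1, √Λ_δ) → min(1, η) = η`; `F` is differentiable on `|u| < 1` (`CardyFSpec.hasDerivAt_cardyF`, PROVED
in the closed support item `CardyFSpec`, stmt-CriticalPhenomena-4516), hence `F(min(1, √Λ_δ)) → F(η)`; add
S2. The two stubs together are EQUIVALENT to the crux given S1 (crux ∧ S1 ⇒ S2 by the same three lines
run backwards), so the cut loses nothing and hides nothing: S1 is the printed-in-principle potential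
theory, S2 is the open SAW statement in its sharpest lattice form.

Not registered here (alternative cuts, recorded in `Lines/birth.md`): (i) S2 ⇐ S2[boundary endpoints] +
endpoint-insensitivity of `N_δ` (needs an existence lemma for boundary-vertex endpoint approximations the
tree does not have: `SAW.exists_isEndpointApprox` builds interior ones); (ii) the "annealed 5/8-restriction"
cut `N_δ = E_ω[P_SAW(γ ∩ ω = ∅)] ≈ E_ω[(G_{Ω_δ∖ω}(a_δ,b_δ)/G_{Ω_δ}(a_δ,b_δ))^{5/8}] → F(η)` (SAW restriction
in random-walk-ruler form + a pure two-excursion RW limit whose continuum value is Kozdron 2009 Thm 8.1 via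
LSW03) — a different LINE, for a crux-ideate seat.

No `Disproof.lean` exists for this crux (`ledger crux ls stmt-CriticalPhenomena-4511`: no workfiles,
2026-08-17); negatives index checked (no statement about the excursion observable or the RW cross-ratio).
-/

noncomputable section

open MeasureTheory Filter Topology Set
open Literature.Probability.RandomPlanarGeometry Literature.Probability.LatticeModels
open UpperHalfPlane (upperHalfPlaneSet)

namespace Summit.CriticalPhenomena.SAWScalingLimit.Cruxes.ExcursionCardyFormula.Birth

/-! ### Vocabulary of the line -/

/-- The **random-walk cross-ratio** `Λ_δ = G(a_δ,d_δ) G(c_δ,b_δ) / (G(a_δ,c_δ) G(d_δ,b_δ))` of the four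
lattice points in `Ω_δ`, `G = SRW.killedGreen (discreteDomainGraph Ω δ)` (the route's inline `let Gf`,
`SRW.killedGreen_def`). Junk `0` when a denominator vanishes. -/
def rwCrossRatio (Ω : Set ℂ) (δ : ℝ) (a b c d : Site 2) : ℝ :=
  SRW.killedGreen (discreteDomainGraph Ω δ) a d * SRW.killedGreen (discreteDomainGraph Ω δ) c b /
    (SRW.killedGreen (discreteDomainGraph Ω δ) a c * SRW.killedGreen (discreteDomainGraph Ω δ) d b)

/-- **S1, named.** The random-walk cross-ratio of `(a_δ, c_δ, d_δ, b_δ)` tends to Cardy's cross-ratio of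
every uniformizing datum (the route's support item `RWGreenCrossRatioLimit`, stmt-CriticalPhenomena-4515). -/
def RWCrossRatioLimit : Prop :=
  ∀ (R : ConformalRectangle) (a b c d : ℝ → Site 2),
    SAW.IsEndpointApprox (R.chord 0 3 (by decide)) a b →
    Tendsto (fun δ => meshPoint δ (c δ)) (𝓝[>] 0) (𝓝 (R.pt 1)) →
    Tendsto (fun δ => meshPoint δ (d δ)) (𝓝[>] 0) (𝓝 (R.pt 2)) →
    (∀ᶠ δ in 𝓝[>] 0, c δ ∈ meshBoundary R.carrier δ ∧ d δ ∈ meshBoundary R.carrier δ) →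
    ∀ (φ : ConformalEquiv upperHalfPlaneSet R.carrier) (x : Fin 4 → ℝ), R.IsUniformizing φ x →
      Tendsto (fun δ => Real.sqrt (rwCrossRatio R.carrier δ (a δ) (b δ) (c δ) (d δ)))
        (𝓝[>] 0) (𝓝 (crossRatio x))

/-- **S2, named.** The SAW × excursion non-intersection probability tracks the Cardy–Fomin function of the
random-walk cross-ratio of the same lattice domain: `N_δ − F(min(1, √Λ_δ)) → 0`. -/
def AvoidanceTracksRWCrossRatio : Prop :=
  ∀ (R : ConformalRectangle) (a b c d : ℝ → Site 2),
    SAW.IsEndpointApprox (R.chord 0 3 (by decide)) a b →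
    Tendsto (fun δ => meshPoint δ (c δ)) (𝓝[>] 0) (𝓝 (R.pt 1)) →
    Tendsto (fun δ => meshPoint δ (d δ)) (𝓝[>] 0) (𝓝 (R.pt 2)) →
    (∀ᶠ δ in 𝓝[>] 0, c δ ∈ meshBoundary R.carrier δ ∧ d δ ∈ meshBoundary R.carrier δ) →
    Tendsto (fun δ => SAW.excursionAvoidance R.carrier δ (a δ) (b δ) (c δ) (d δ) -
        sawExcursionF (min 1 (Real.sqrt (rwCrossRatio R.carrier δ (a δ) (b δ) (c δ) (d δ)))))
      (𝓝[>] 0) (𝓝 0)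

/-! ### The stubs (the ONLY `sorry`s of this file)

Stated over TREE VOCABULARY ONLY (`rwCrossRatio` unfolded by hand), so that each lands verbatim as a
`Theorems/SAWExcursionCardyExcursionCardyFormula<Stub>.lean --supports stmt-CriticalPhenomena-4511`
without importing this workfile. -/

/-- **S1 — the random-walk cross-ratio converges to Cardy's cross-ratio.** For a conformal rectangle
`R = (Ω; a, c, d, b)`, an endpoint approximation `(a_δ, b_δ)` of `(Ω; a, b)`, boundary vertices
`c_δ → c`, `d_δ → d` and a uniformizing datum `(φ, x)`:
`√(G(a_δ,d_δ) G(c_δ,b_δ) / (G(a_δ,c_δ) G(d_δ,b_δ))) → crossRatio x`, `G = SRW.killedGreen (Ω_δ)`.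
Kozdron–Lawler 2005 Thm 1.1 / Prop. 3.10 read along `Ω_δ → Ω` (local factors cancel in the 4-ratio) +
boundary Harnack for possibly interior `a_δ, b_δ`; in the tree it follows from the route's crux
`MartinRatioBoundaryLimit` by `Theorems.RWGreenCrossRatioLimit_of_martinRatioBoundaryLimit`. This IS the
route item `RWGreenCrossRatioLimit` (stmt-CriticalPhenomena-4515), `Iff.rfl`. -/
theorem stub_rwCrossRatioLimit :
    ∀ (R : ConformalRectangle) (a b c d : ℝ → Site 2),
      SAW.IsEndpointApprox (R.chord 0 3 (by decide)) a b →
      Tendsto (fun δ => meshPoint δ (c δ)) (𝓝[>] 0) (𝓝 (R.pt 1)) →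
      Tendsto (fun δ => meshPoint δ (d δ)) (𝓝[>] 0) (𝓝 (R.pt 2)) →
      (∀ᶠ δ in 𝓝[>] 0, c δ ∈ meshBoundary R.carrier δ ∧ d δ ∈ meshBoundary R.carrier δ) →
      ∀ (φ : ConformalEquiv upperHalfPlaneSet R.carrier) (x : Fin 4 → ℝ), R.IsUniformizing φ x →
        Tendsto (fun δ => Real.sqrt
          (SRW.killedGreen (discreteDomainGraph R.carrier δ) (a δ) (d δ) *
            SRW.killedGreen (discreteDomainGraph R.carrier δ) (c δ) (b δ) /
            (SRW.killedGreen (discreteDomainGraph R.carrier δ) (a δ) (c δ) *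
              SRW.killedGreen (discreteDomainGraph R.carrier δ) (d δ) (b δ))))
          (𝓝[>] 0) (𝓝 (crossRatio x)) := by
  sorry

/-- **S2 (hardest) — the non-intersection probability tracks `F` of the random-walk cross-ratio.**
For `R`, `(a_δ, b_δ)`, `c_δ`, `d_δ` as in S1 (NO uniformizing datum):
`N_δ − F(min(1, √Λ_δ)) → 0` as `δ → 0⁺`, where `N_δ = SAW.excursionAvoidance Ω δ a_δ b_δ c_δ d_δ` is the
probability that the critical SAW of `Ω_δ` from `a_δ` to `b_δ` and an independent random-walk excursion of
`Ω_δ` from `c_δ` to `d_δ` are vertex-disjoint, `F = sawExcursionF` and `Λ_δ` is the random-walk cross-ratio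
of S1. The `η = nil` content of the route's crux `SlitExcursionCardy`; conformal invariance of a SAW
functional in purely lattice terms (LSW 2004 §3.4; Kozdron 2007 Thm 6.1 is the `κ = 2` / LERW analogue,
where Fomin's identity makes it a theorem). -/
theorem stub_avoidanceTracksRWCrossRatio :
    ∀ (R : ConformalRectangle) (a b c d : ℝ → Site 2),
      SAW.IsEndpointApprox (R.chord 0 3 (by decide)) a b →
      Tendsto (fun δ => meshPoint δ (c δ)) (𝓝[>] 0) (𝓝 (R.pt 1)) →
      Tendsto (fun δ => meshPoint δ (d δ)) (𝓝[>] 0) (𝓝 (R.pt 2)) →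
      (∀ᶠ δ in 𝓝[>] 0, c δ ∈ meshBoundary R.carrier δ ∧ d δ ∈ meshBoundary R.carrier δ) →
      Tendsto (fun δ => SAW.excursionAvoidance R.carrier δ (a δ) (b δ) (c δ) (d δ) -
          sawExcursionF (min 1 (Real.sqrt
            (SRW.killedGreen (discreteDomainGraph R.carrier δ) (a δ) (d δ) *
              SRW.killedGreen (discreteDomainGraph R.carrier δ) (c δ) (b δ) /
              (SRW.killedGreen (discreteDomainGraph R.carrier δ) (a δ) (c δ) *
                SRW.killedGreen (discreteDomainGraph R.carrier δ) (d δ) (b δ))))))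
        (𝓝[>] 0) (𝓝 0) := by
  sorry

/-! ### Consistency: each named statement IS its registered stub (definitionally), and S1 IS the route's
support item `RWGreenCrossRatioLimit` (stmt-CriticalPhenomena-4515) -/

theorem rwCrossRatioLimit_holds : RWCrossRatioLimit := stub_rwCrossRatioLimit
theorem avoidanceTracksRWCrossRatio_holds : AvoidanceTracksRWCrossRatio :=
  stub_avoidanceTracksRWCrossRatio

/-- S1 is, literally, the route's support item `RWGreenCrossRatioLimit` (its inline `let Gf` is
`SRW.killedGreen`, `SRW.killedGreen_def`): closing stmt-CriticalPhenomena-4515 discharges S1 verbatim. -/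
example : RWCrossRatioLimit ↔
    Summit.CriticalPhenomena.SAWScalingLimit.Theses.SAWExcursionCardy.RWGreenCrossRatioLimit :=
  Iff.rfl

/-! ### Name-keyed aliases of the two statements — the hypotheses of `ExcursionCardyFormula_of`

The native skeleton audit (`#h21_check_skeleton`) admits a hypothesis of the skeleton theorem only if its head
constant is a registered obligation or is NAMED like a declared stub; `__Registered.stub_X` is the statement of
`stub_X` under that name (device of `Cruxes/AxiomsOfLimit/Lines/birth.lean`; the `__` namespace is an
implementation detail, so the audit's stub report resolves each `stub_…` to the sorried theorem, not to the
alias). Each alias is `rfl`-equal to its statement. -/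
namespace __Registered

/-- Alias of `RWCrossRatioLimit` keyed by the registered stub name. -/
abbrev stub_rwCrossRatioLimit : Prop := RWCrossRatioLimit
/-- Alias of `AvoidanceTracksRWCrossRatio` keyed by the registered stub name. -/
abbrev stub_avoidanceTracksRWCrossRatio : Prop := AvoidanceTracksRWCrossRatio

end __Registered

/-! ### The skeleton theorem: the two stubs imply the crux, BY NAME -/

/-- **`ExcursionCardyFormula` from the line `birth`** (kernel-checked, no `sorry` of its own). Fix `R`, the
approximations and a uniformizing datum `(φ, x)`; `η = crossRatio x ∈ (0, 1)`
(`crossRatio_mem_Ioo_of_isUniformizing`). By S1, `min(1, √Λ_δ) → min(1, η) = η`; `F` is differentiable on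
the open unit ball (`CardyFSpec.hasDerivAt_cardyF`, proved for the closed support item `CardyFSpec`), so
`F(min(1, √Λ_δ)) → F(η)`; adding S2 gives `N_δ → F(η)`. The crux's inline `let E / N / F` are
`SRWExcursion.exitAfterAvoiding`, `SAW.excursionAvoidance`, `sawExcursionF` definitionally. Hypotheses = the
two stubs, under their registered names; conclusion = the route decl, by name. -/
theorem ExcursionCardyFormula_of (hRW : __Registered.stub_rwCrossRatioLimit)
    (hSAW : __Registered.stub_avoidanceTracksRWCrossRatio) :
    Summit.CriticalPhenomena.SAWScalingLimit.Theses.SAWExcursionCardy.ExcursionCardyFormula := by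
  intro R a b c d hab hc hd hbd E N F φ x hφ
  -- the target cross-ratio is an interior point of `[0, 1]`
  have hη : crossRatio x ∈ Ioo (0 : ℝ) 1 := ConformalRectangle.crossRatio_mem_Ioo_of_isUniformizing hφ
  -- S1: the random-walk cross-ratio converges to `η`, hence so does `min 1 √Λ_δ`
  have h1 : Tendsto (fun δ => Real.sqrt (rwCrossRatio R.carrier δ (a δ) (b δ) (c δ) (d δ)))
      (𝓝[>] 0) (𝓝 (crossRatio x)) := hRW R a b c d hab hc hd hbd φ x hφ
  have hmin : Tendsto (fun δ => min 1 (Real.sqrt (rwCrossRatio R.carrier δ (a δ) (b δ) (c δ) (d δ))))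
      (𝓝[>] 0) (𝓝 (crossRatio x)) := by
    have h := (tendsto_const_nhds (x := (1 : ℝ))).min h1
    rwa [min_eq_right hη.2.le] at h
  -- `F` is continuous at `η` (differentiable on `|u| < 1`)
  have habs : |crossRatio x| < 1 := by
    rw [abs_lt]
    exact ⟨by linarith [hη.1], hη.2⟩
  have hFc : ContinuousAt (fun u : ℝ => (8 / 5 : ℝ) * u * ₂F₁ (-1 / 2 : ℝ) (2 : ℝ) (7 / 2 : ℝ) u)
      (crossRatio x) :=
    (Summit.CriticalPhenomena.SAWScalingLimit.Theorems.CardyFSpec.hasDerivAt_cardyF habs).continuousAt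
  have hF : Tendsto
      (fun δ => sawExcursionF (min 1 (Real.sqrt (rwCrossRatio R.carrier δ (a δ) (b δ) (c δ) (d δ)))))
      (𝓝[>] 0) (𝓝 (sawExcursionF (crossRatio x))) :=
    hFc.tendsto.comp hmin
  -- S2 + the limit of `F(min 1 √Λ_δ)`
  have h2 : Tendsto (fun δ => SAW.excursionAvoidance R.carrier δ (a δ) (b δ) (c δ) (d δ) -
      sawExcursionF (min 1 (Real.sqrt (rwCrossRatio R.carrier δ (a δ) (b δ) (c δ) (d δ)))))
      (𝓝[>] 0) (𝓝 0) := hSAW R a b c d hab hc hd hbd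
  have hsum := h2.add hF
  simp only [sub_add_cancel, zero_add] at hsum
  -- the crux's inline observable and target function are the tree's, definitionally
  show Tendsto (fun δ => SAW.excursionAvoidance R.carrier δ (a δ) (b δ) (c δ) (d δ)) (𝓝[>] 0)
    (𝓝 (sawExcursionF (crossRatio x)))
  exact hsum

/-- Wiring check (an `example`, so that `ExcursionCardyFormula_of` stays the only theorem concluding the
crux): the registered stubs, with their tree-vocabulary types, feed the skeleton theorem as stated — this term
becomes the crux proof when the two `sorry`s above are discharged. -/
example : Summit.CriticalPhenomena.SAWScalingLimit.Theses.SAWExcursionCardy.ExcursionCardyFormula :=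
  ExcursionCardyFormula_of stub_rwCrossRatioLimit stub_avoidanceTracksRWCrossRatio

end Summit.CriticalPhenomena.SAWScalingLimit.Cruxes.ExcursionCardyFormula.Birth

end
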